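import Mathlib
import Summits.Ventures.PercRepro2.V2SP
import Summits.Ventures.PercRepro2.Tail2DCount
import Summits.Ventures.PercRepro2.Tail2DThreePoint
import Summits.Ventures.PercRepro2.Tail2DP2Series
import Summits.Ventures.PercRepro2.Tail2DDisjointPaths
import Summits.Ventures.PercRepro2.Tail2DP2SeriesSP
import Summits.Ventures.PercRepro2.Tail2DAxisUnimodal
import Summits.Ventures.PercRepro2.Tail2DOffAxis31
import Summits.Ventures.PercRepro2.Tail2DOffAxis41
import Summits.Ventures.PercRepro2.Tail2DOffAxis51
import Summits.Ventures.PercRepro2.Tail2DOffAxis61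

/-!
# Off the axis, fifth member: `T(7,1) ≤ T(6,2)` on every series–parallel network (seat mine-b, cell pub-perc-repro2)

For every pattern `s` of the cell's grammar, uniformly two-coloured,

  `#{r ≥ 7 ∧ b ≥ 1} ≤ #{r ≥ 6 ∧ b ≥ 2}`   (`t71_le_t62`),

the member `(a, j) = (7, 1)` of the off-axis anti-diagonal unimodality `T(a, j) ≤ T(a−1, j+1)`.  Same
proof as for `(3,1)`, `(4,1)`, `(5,1)`: series multiplies the tails; for a parallel composition both tails are
bilinear in the capped cells of the factors (`K = 7`, `tail_par_rows`, `tail_cellsK`), and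
`T(6,2) − T(7,1)` of the composition is the instance `a = 7` of the GENERAL certificate of the row `j = 1`
(registry §36.5; an exact identity of bilinear forms on symmetric arrays, verified for `3 ≤ a ≤ 9`):

  `Σ_{k=3}^{a} [D₁(k,0)·Z₂(a+1−k) + Z₁(a+1−k)·D₂(k,0)] + Σ_{k=3}^{a} [D₁(k,1)·N₂(0,a−k) + N₁(0,a−k)·D₂(k,1)]
   + Σ_{k=2}^{a−1} [D₁(k,0)·D₂(a+1−k,0) + Z₁(k)·Z₂(a+1−k)]`,

`D(a, j) = T(a−1, j+1) − T(a, j)`, `Z(v) = #{r = 0, b ≥ v}`, `N(0,y) = #{r = 0, b = y}`: `30` products of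
non-negative factors, with the axis theorems `D(2,0) … D(7,0)`, the landed members `D(3,1) … D(6,1)` and the
induction hypothesis `D(7,1)` of the factors.
-/

namespace Summit.Ventures.PercRepro2.Tail2D

open V2Closure

set_option maxHeartbeats 4000000 in
/-- the parallel step of `T(7,1) ≤ T(6,2)` (the cell rewriting and the 30-product `linarith` need a larger
heartbeat budget than the `K = 4` member) -/
lemma t71_le_t62_par (s t : V2Closure.SP)
    (hs : (Finset.univ.filter (fun y : s.Conf => 7 ≤ s.rLab y ∧ 1 ≤ s.bLab y)).card
      ≤ (Finset.univ.filter (fun y : s.Conf => 6 ≤ s.rLab y ∧ 2 ≤ s.bLab y)).card)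
    (ht : (Finset.univ.filter (fun y : t.Conf => 7 ≤ t.rLab y ∧ 1 ≤ t.bLab y)).card
      ≤ (Finset.univ.filter (fun y : t.Conf => 6 ≤ t.rLab y ∧ 2 ≤ t.bLab y)).card) :
    (Finset.univ.filter (fun p : (V2Closure.SP.par s t).Conf =>
        7 ≤ (V2Closure.SP.par s t).rLab p ∧ 1 ≤ (V2Closure.SP.par s t).bLab p)).card
      ≤ (Finset.univ.filter (fun p : (V2Closure.SP.par s t).Conf =>
        6 ≤ (V2Closure.SP.par s t).rLab p ∧ 2 ≤ (V2Closure.SP.par s t).bLab p)).card := by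
  -- the theorems for the factors: the axis `D(2,0) … D(7,0)` and the landed `D(3,1) … D(6,1)`
  have a2s := tail_axis_unimodal s 1
  have a3s := tail_axis_unimodal s 2
  have a4s := tail_axis_unimodal s 3
  have a5s := tail_axis_unimodal s 4
  have a6s := tail_axis_unimodal s 5
  have a7s := tail_axis_unimodal s 6
  have b31s := t31_le_t22 s
  have b41s := t41_le_t32 s
  have b51s := t51_le_t42 s
  have b61s := t61_le_t52 s
  have a2t := tail_axis_unimodal t 1
  have a3t := tail_axis_unimodal t 2
  have a4t := tail_axis_unimodal t 3
  have a5t := tail_axis_unimodal t 4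
  have a6t := tail_axis_unimodal t 5
  have a7t := tail_axis_unimodal t 6
  have b31t := t31_le_t22 t
  have b41t := t41_le_t32 t
  have b51t := t51_le_t42 t
  have b61t := t61_le_t52 t
  rw [tail_b0] at a2s a3s a4s a5s a6s a7s a2t a3t a4t a5t a6t a7t
  -- everything in the cells (`K = 7`)
  rw [tail_cellsK s 7 7 1 (by norm_num) (by norm_num), tail_cellsK s 7 6 2 (by norm_num) (by norm_num)] at hs
  rw [tail_cellsK s 7 2 0 (by norm_num) (by norm_num), tail_cellsK s 7 1 1 (by norm_num) (by norm_num)] at a2s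
  rw [tail_cellsK s 7 3 0 (by norm_num) (by norm_num), tail_cellsK s 7 2 1 (by norm_num) (by norm_num)] at a3s
  rw [tail_cellsK s 7 4 0 (by norm_num) (by norm_num), tail_cellsK s 7 3 1 (by norm_num) (by norm_num)] at a4s
  rw [tail_cellsK s 7 5 0 (by norm_num) (by norm_num), tail_cellsK s 7 4 1 (by norm_num) (by norm_num)] at a5s
  rw [tail_cellsK s 7 6 0 (by norm_num) (by norm_num), tail_cellsK s 7 5 1 (by norm_num) (by norm_num)] at a6s
  rw [tail_cellsK s 7 7 0 (by norm_num) (by norm_num), tail_cellsK s 7 6 1 (by norm_num) (by norm_num)] at a7s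
  rw [tail_cellsK s 7 3 1 (by norm_num) (by norm_num), tail_cellsK s 7 2 2 (by norm_num) (by norm_num)] at b31s
  rw [tail_cellsK s 7 4 1 (by norm_num) (by norm_num), tail_cellsK s 7 3 2 (by norm_num) (by norm_num)] at b41s
  rw [tail_cellsK s 7 5 1 (by norm_num) (by norm_num), tail_cellsK s 7 4 2 (by norm_num) (by norm_num)] at b51s
  rw [tail_cellsK s 7 6 1 (by norm_num) (by norm_num), tail_cellsK s 7 5 2 (by norm_num) (by norm_num)] at b61s
  rw [tail_cellsK t 7 7 1 (by norm_num) (by norm_num), tail_cellsK t 7 6 2 (by norm_num) (by norm_num)] at ht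
  rw [tail_cellsK t 7 2 0 (by norm_num) (by norm_num), tail_cellsK t 7 1 1 (by norm_num) (by norm_num)] at a2t
  rw [tail_cellsK t 7 3 0 (by norm_num) (by norm_num), tail_cellsK t 7 2 1 (by norm_num) (by norm_num)] at a3t
  rw [tail_cellsK t 7 4 0 (by norm_num) (by norm_num), tail_cellsK t 7 3 1 (by norm_num) (by norm_num)] at a4t
  rw [tail_cellsK t 7 5 0 (by norm_num) (by norm_num), tail_cellsK t 7 4 1 (by norm_num) (by norm_num)] at a5t
  rw [tail_cellsK t 7 6 0 (by norm_num) (by norm_num), tail_cellsK t 7 5 1 (by norm_num) (by norm_num)] at a6t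
  rw [tail_cellsK t 7 7 0 (by norm_num) (by norm_num), tail_cellsK t 7 6 1 (by norm_num) (by norm_num)] at a7t
  rw [tail_cellsK t 7 3 1 (by norm_num) (by norm_num), tail_cellsK t 7 2 2 (by norm_num) (by norm_num)] at b31t
  rw [tail_cellsK t 7 4 1 (by norm_num) (by norm_num), tail_cellsK t 7 3 2 (by norm_num) (by norm_num)] at b41t
  rw [tail_cellsK t 7 5 1 (by norm_num) (by norm_num), tail_cellsK t 7 4 2 (by norm_num) (by norm_num)] at b51t
  rw [tail_cellsK t 7 6 1 (by norm_num) (by norm_num), tail_cellsK t 7 5 2 (by norm_num) (by norm_num)] at b61t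
  rw [tail_par_rows s t 7 7 1 (by norm_num) (by norm_num), tail_par_rows s t 7 6 2 (by norm_num) (by norm_num)]
  simp only [Finset.sum_range_succ, Finset.sum_range_zero]
  rw [tail_cellsK t 7 7 1 (by norm_num) (by norm_num),
    tail_cellsK t 7 7 0 (by norm_num) (by norm_num),
    tail_cellsK t 7 6 2 (by norm_num) (by norm_num),
    tail_cellsK t 7 6 1 (by norm_num) (by norm_num),
    tail_cellsK t 7 6 0 (by norm_num) (by norm_num),
    tail_cellsK t 7 5 2 (by norm_num) (by norm_num),
    tail_cellsK t 7 5 1 (by norm_num) (by norm_num),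
    tail_cellsK t 7 5 0 (by norm_num) (by norm_num),
    tail_cellsK t 7 4 2 (by norm_num) (by norm_num),
    tail_cellsK t 7 4 1 (by norm_num) (by norm_num),
    tail_cellsK t 7 4 0 (by norm_num) (by norm_num),
    tail_cellsK t 7 3 2 (by norm_num) (by norm_num),
    tail_cellsK t 7 3 1 (by norm_num) (by norm_num),
    tail_cellsK t 7 3 0 (by norm_num) (by norm_num),
    tail_cellsK t 7 2 2 (by norm_num) (by norm_num),
    tail_cellsK t 7 2 1 (by norm_num) (by norm_num),
    tail_cellsK t 7 2 0 (by norm_num) (by norm_num),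
    tail_cellsK t 7 1 2 (by norm_num) (by norm_num),
    tail_cellsK t 7 1 1 (by norm_num) (by norm_num),
    tail_cellsK t 7 1 0 (by norm_num) (by norm_num),
    tail_cellsK t 7 0 2 (by norm_num) (by norm_num),
    tail_cellsK t 7 0 1 (by norm_num) (by norm_num),
    tail_cellsK t 7 0 0 (by norm_num) (by norm_num)]
  simp only [Finset.sum_range_succ, Finset.sum_range_zero] at hs ht a2s a2t a3s a3t a4s a4t a5s a5t a6s a6t a7s a7t b31s b31t b41s b41t b51s b51t b61s b61t ⊢
  norm_num at hs ht a2s a2t a3s a3t a4s a4t a5s a5t a6s a6t a7s a7t b31s b31t b41s b41t b51s b51t b61s b61t ⊢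
  -- mirror cells
  rw [cellCount_symm s 7 1 0, cellCount_symm s 7 2 0, cellCount_symm s 7 2 1, cellCount_symm s 7 3 0, cellCount_symm s 7 3 1, cellCount_symm s 7 3 2, cellCount_symm s 7 4 0, cellCount_symm s 7 4 1, cellCount_symm s 7 4 2, cellCount_symm s 7 4 3, cellCount_symm s 7 5 0, cellCount_symm s 7 5 1, cellCount_symm s 7 5 2, cellCount_symm s 7 5 3, cellCount_symm s 7 5 4, cellCount_symm s 7 6 0, cellCount_symm s 7 6 1, cellCount_symm s 7 6 2, cellCount_symm s 7 6 3, cellCount_symm s 7 6 4, cellCount_symm s 7 6 5, cellCount_symm s 7 7 0, cellCount_symm s 7 7 1, cellCount_symm s 7 7 2, cellCount_symm s 7 7 3, cellCount_symm s 7 7 4, cellCount_symm s 7 7 5, cellCount_symm s 7 7 6, cellCount_symm t 7 1 0, cellCount_symm t 7 2 0, cellCount_symm t 7 2 1, cellCount_symm t 7 3 0, cellCount_symm t 7 3 1, cellCount_symm t 7 3 2, cellCount_symm t 7 4 0, cellCount_symm t 7 4 1, cellCount_symm t 7 4 2, cellCount_symm t 7 4 3, cellCount_symm t 7 5 0, cellCount_symm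 t 7 5 1, cellCount_symm t 7 5 2, cellCount_symm t 7 5 3, cellCount_symm t 7 5 4, cellCount_symm t 7 6 0, cellCount_symm t 7 6 1, cellCount_symm t 7 6 2, cellCount_symm t 7 6 3, cellCount_symm t 7 6 4, cellCount_symm t 7 6 5, cellCount_symm t 7 7 0, cellCount_symm t 7 7 1, cellCount_symm t 7 7 2, cellCount_symm t 7 7 3, cellCount_symm t 7 7 4, cellCount_symm t 7 7 5, cellCount_symm t 7 7 6] at *
  -- the certificate (registry §36.5, `a = 7`)
  zify at hs ht a2s a2t a3s a3t a4s a4t a5s a5t a6s a6t a7s a7t b31s b31t b41s b41t b51s b51t b61s b61t ⊢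
  have h1 := mul_nonneg (sub_nonneg.2 a3s) (by positivity : (0 : ℤ) ≤ cellCount t 7 0 5 + cellCount t 7 0 6 + cellCount t 7 0 7)
  have h2 := mul_nonneg (by positivity : (0 : ℤ) ≤ cellCount s 7 0 5 + cellCount s 7 0 6 + cellCount s 7 0 7) (sub_nonneg.2 a3t)
  have h3 := mul_nonneg (sub_nonneg.2 a4s) (by positivity : (0 : ℤ) ≤ cellCount t 7 0 4 + cellCount t 7 0 5 + cellCount t 7 0 6 + cellCount t 7 0 7)
  have h4 := mul_nonneg (by positivity : (0 : ℤ) ≤ cellCount s 7 0 4 + cellCount s 7 0 5 + cellCount s 7 0 6 + cellCount s 7 0 7) (sub_nonneg.2 a4t)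
  have h5 := mul_nonneg (sub_nonneg.2 a5s) (by positivity : (0 : ℤ) ≤ cellCount t 7 0 3 + cellCount t 7 0 4 + cellCount t 7 0 5 + cellCount t 7 0 6 + cellCount t 7 0 7)
  have h6 := mul_nonneg (by positivity : (0 : ℤ) ≤ cellCount s 7 0 3 + cellCount s 7 0 4 + cellCount s 7 0 5 + cellCount s 7 0 6 + cellCount s 7 0 7) (sub_nonneg.2 a5t)
  have h7 := mul_nonneg (sub_nonneg.2 a6s) (by positivity : (0 : ℤ) ≤ cellCount t 7 0 2 + cellCount t 7 0 3 + cellCount t 7 0 4 + cellCount t 7 0 5 + cellCount t 7 0 6 + cellCount t 7 0 7)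
  have h8 := mul_nonneg (by positivity : (0 : ℤ) ≤ cellCount s 7 0 2 + cellCount s 7 0 3 + cellCount s 7 0 4 + cellCount s 7 0 5 + cellCount s 7 0 6 + cellCount s 7 0 7) (sub_nonneg.2 a6t)
  have h9 := mul_nonneg (sub_nonneg.2 a7s) (by positivity : (0 : ℤ) ≤ cellCount t 7 0 1 + cellCount t 7 0 2 + cellCount t 7 0 3 + cellCount t 7 0 4 + cellCount t 7 0 5 + cellCount t 7 0 6 + cellCount t 7 0 7)
  have h10 := mul_nonneg (by positivity : (0 : ℤ) ≤ cellCount s 7 0 1 + cellCount s 7 0 2 + cellCount s 7 0 3 + cellCount s 7 0 4 + cellCount s 7 0 5 + cellCount s 7 0 6 + cellCount s 7 0 7) (sub_nonneg.2 a7t)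
  have h11 := mul_nonneg (sub_nonneg.2 b31s) (by positivity : (0 : ℤ) ≤ cellCount t 7 0 4)
  have h12 := mul_nonneg (by positivity : (0 : ℤ) ≤ cellCount s 7 0 4) (sub_nonneg.2 b31t)
  have h13 := mul_nonneg (sub_nonneg.2 b41s) (by positivity : (0 : ℤ) ≤ cellCount t 7 0 3)
  have h14 := mul_nonneg (by positivity : (0 : ℤ) ≤ cellCount s 7 0 3) (sub_nonneg.2 b41t)
  have h15 := mul_nonneg (sub_nonneg.2 b51s) (by positivity : (0 : ℤ) ≤ cellCount t 7 0 2)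
  have h16 := mul_nonneg (by positivity : (0 : ℤ) ≤ cellCount s 7 0 2) (sub_nonneg.2 b51t)
  have h17 := mul_nonneg (sub_nonneg.2 b61s) (by positivity : (0 : ℤ) ≤ cellCount t 7 0 1)
  have h18 := mul_nonneg (by positivity : (0 : ℤ) ≤ cellCount s 7 0 1) (sub_nonneg.2 b61t)
  have h19 := mul_nonneg (sub_nonneg.2 hs) (by positivity : (0 : ℤ) ≤ cellCount t 7 0 0)
  have h20 := mul_nonneg (by positivity : (0 : ℤ) ≤ cellCount s 7 0 0) (sub_nonneg.2 ht)
  have h21 := mul_nonneg (sub_nonneg.2 a2s) (sub_nonneg.2 a6t)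
  have h22 := mul_nonneg (sub_nonneg.2 a3s) (sub_nonneg.2 a5t)
  have h23 := mul_nonneg (sub_nonneg.2 a4s) (sub_nonneg.2 a4t)
  have h24 := mul_nonneg (sub_nonneg.2 a5s) (sub_nonneg.2 a3t)
  have h25 := mul_nonneg (sub_nonneg.2 a6s) (sub_nonneg.2 a2t)
  have h26 := mul_nonneg (by positivity : (0 : ℤ) ≤ cellCount s 7 0 2 + cellCount s 7 0 3 + cellCount s 7 0 4 + cellCount s 7 0 5 + cellCount s 7 0 6 + cellCount s 7 0 7) (by positivity : (0 : ℤ) ≤ cellCount t 7 0 6 + cellCount t 7 0 7)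
  have h27 := mul_nonneg (by positivity : (0 : ℤ) ≤ cellCount s 7 0 3 + cellCount s 7 0 4 + cellCount s 7 0 5 + cellCount s 7 0 6 + cellCount s 7 0 7) (by positivity : (0 : ℤ) ≤ cellCount t 7 0 5 + cellCount t 7 0 6 + cellCount t 7 0 7)
  have h28 := mul_nonneg (by positivity : (0 : ℤ) ≤ cellCount s 7 0 4 + cellCount s 7 0 5 + cellCount s 7 0 6 + cellCount s 7 0 7) (by positivity : (0 : ℤ) ≤ cellCount t 7 0 4 + cellCount t 7 0 5 + cellCount t 7 0 6 + cellCount t 7 0 7)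
  have h29 := mul_nonneg (by positivity : (0 : ℤ) ≤ cellCount s 7 0 5 + cellCount s 7 0 6 + cellCount s 7 0 7) (by positivity : (0 : ℤ) ≤ cellCount t 7 0 3 + cellCount t 7 0 4 + cellCount t 7 0 5 + cellCount t 7 0 6 + cellCount t 7 0 7)
  have h30 := mul_nonneg (by positivity : (0 : ℤ) ≤ cellCount s 7 0 6 + cellCount s 7 0 7) (by positivity : (0 : ℤ) ≤ cellCount t 7 0 2 + cellCount t 7 0 3 + cellCount t 7 0 4 + cellCount t 7 0 5 + cellCount t 7 0 6 + cellCount t 7 0 7)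
  linarith [h1, h2, h3, h4, h5, h6, h7, h8, h9, h10, h11, h12, h13, h14, h15, h16, h17, h18, h19, h20, h21, h22, h23, h24, h25, h26, h27, h28, h29, h30]

/-- **seven disjoint red paths with a blue path are rarer than six disjoint red paths with two
disjoint blue paths**, on every pattern of the grammar: `T(7,1) ≤ T(6,2)` -/
theorem t71_le_t62 : ∀ s : V2Closure.SP,
    (Finset.univ.filter (fun y : s.Conf => 7 ≤ s.rLab y ∧ 1 ≤ s.bLab y)).card
      ≤ (Finset.univ.filter (fun y : s.Conf => 6 ≤ s.rLab y ∧ 2 ≤ s.bLab y)).card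
  | .free => by decide
  | .pin => by decide
  | .absent => by decide
  | .ser s t => by
    rw [card_tail_ser, card_tail_ser]
    exact Nat.mul_le_mul (t71_le_t62 s) (t71_le_t62 t)
  | .par s t => t71_le_t62_par s t (t71_le_t62 s) (t71_le_t62 t)

/-- the same in the vocabulary of `Tail2DP2Series` -/
theorem stat_t71_le_t62 (s : V2Closure.SP) :
    stat s (fun r b => 7 ≤ r ∧ 1 ≤ b) ≤ stat s (fun r b => 6 ≤ r ∧ 2 ≤ b) :=
  t71_le_t62 s

end Summit.Ventures.PercRepro2.Tail2D
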